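import Literature.GroupTheory.Transfer.TransferTransitivity
import Mathlib.GroupTheory.Abelianization.Defs

/-!
# The transfer followed by the inclusion is the `[G : H]`-th power (Cor ∘ Res = index in degree `H₁`)

J.-P. Serre, *Local Fields* (GTM 67, 1979), Chap. VII §7 Prop. 6 ("`Cor ∘ Res = n`", `n = (G : H)`)
and §8 (the transfer `Ver : G^ab → H^ab` is the restriction in homological degree one)
[cite: Serre1979, VII §7 Prop. 6].  The homological-degree-one instance, made explicit on elements:
for a subgroup `H ≤ G` of finite index `n`, the composite of the transfer `Ver : G → H^ab`-valued in
`G^ab` (i.e. the transfer of the homomorphism `H ↪ G ↠ G^ab`) is `g ↦ ḡ ^ n` — from the product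
formula of Prop. 7 (`transfer_eq_prod_section`, this directory): the factors
`ρ(g·q)⁻¹ g ρ(q)` multiply in `G^ab` to `ḡ^n · ∏ ρ(q) · (∏ ρ(g·q))⁻¹ = ḡ^n`, the two products being
equal by reindexing along the permutation `q ↦ g·q`.  Used in the abc-iut cell for the index factor
of [AbsTopIII] Rmk. 1.10.1 (i) (open injections of Galois groups act on cyclotomes by the index).
Pure group theory; states nothing about IUT.
-/

noncomputable section

namespace Literature.GroupTheory.Transfer

open MulAction Subgroup

variable {G : Type*} [Group G] {H : Subgroup G}

/-- **`ι_* ∘ Ver = (G : H)`**: the transfer of `H ↪ G ↠ G^ab` sends `g` to `ḡ ^ [G : H]`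
(Serre, *Local Fields* VII §7 Prop. 6 in degree `H₁`, via the product formula of §8 Prop. 7).
[cite: Serre1979, VII §7 Prop. 6] -/
theorem transfer_of_comp_subtype_eq_pow [H.FiniteIndex] (g : G) :
    MonoidHom.transfer ((Abelianization.of (G := G)).comp H.subtype) g =
      Abelianization.of g ^ H.index := by
  letI := H.fintypeQuotientOfFiniteIndex
  have hρ : ∀ q : G ⧸ H, ((Quotient.out q : G) : G ⧸ H) = q := fun q => Quotient.out_eq q
  rw [transfer_eq_prod_section ((Abelianization.of (G := G)).comp H.subtype) hρ g]
  simp only [MonoidHom.comp_apply, Subgroup.subtype_apply, map_mul, map_inv]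
  rw [Finset.prod_mul_distrib, Finset.prod_mul_distrib, Finset.prod_inv_distrib, Finset.prod_const,
    Finset.card_univ, index_eq_card, Nat.card_eq_fintype_card]
  have hperm : ∏ q : G ⧸ H, Abelianization.of (Quotient.out (g • q)) =
      ∏ q : G ⧸ H, Abelianization.of (Quotient.out q) :=
    Fintype.prod_equiv (MulAction.toPerm g) _ _ fun _ => rfl
  rw [hperm, mul_comm, ← mul_assoc, mul_inv_cancel, one_mul]

/-- The same for any homomorphism `χ : G → A` to an abelian group: the transfer of `χ|_H` is
`χ ^ [G : H]`. [cite: Serre1979, VII §7 Prop. 6] -/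
theorem transfer_restrict_eq_pow {A : Type*} [CommGroup A] [H.FiniteIndex] (χ : G →* A) (g : G) :
    MonoidHom.transfer (χ.comp H.subtype) g = χ g ^ H.index := by
  have hfac : χ.comp H.subtype =
      (Abelianization.lift χ).comp ((Abelianization.of (G := G)).comp H.subtype) := by
    ext h
    simp
  rw [hfac, transfer_comp, MonoidHom.comp_apply, transfer_of_comp_subtype_eq_pow, map_pow,
    Abelianization.lift_apply_of]

end Literature.GroupTheory.Transfer

end
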